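import Mathlib.MeasureTheory.Function.LpSeminorm.Basic
import Mathlib.MeasureTheory.Integral.Lebesgue.Basic
import Mathlib.Order.LiminfLimsup
import Literature.Analysis.FluidPDE.SelfSimilar
import Literature.Analysis.FluidPDE.VectorCalculus
import Literature.Analysis.FluidPDE.AxisymmetricEuler
import HarnessLib

/-!
# Liouville criteria for steady (D-)solutions of the Navier–Stokes equations on `ℝ³`

Topic `Literature/Analysis/FluidPDE`; named facts (results in print, `def … : Prop`, D-0014) requested
by the grounding of route `GaldiLiouvilleGate` of `NavierStokesRegularity` (items
`stmt-NavierStokesRegularity-0895` = `GaldiLiouville`, `…-0896` = `AxisymGaldiLiouville`,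
`…-0897` = `CriticalRateLiouville`, `…-0898` = `NontrivialDSolutionExists`).

**The Liouville problem for D-solutions (OPEN).** A smooth solution of the steady Navier–Stokes
system `−νΔU + (U·∇)U + ∇P = 0`, `div U = 0` on `ℝ³` with finite Dirichlet integral
`∫ |∇U|² < ∞` and `U → 0` at infinity is it identically zero? Posed by Galdi (2011 monograph,
Introduction p. 12, third open problem, and Remark X.9.4) and Tsai (2018, Conjecture 2.5); stated
open in Seregin–Wang 2020 (§1: "has not been solved yet"), in Wang's 2025 monograph (Preface) and in
Wang–Yang, arXiv:2608.06040 (Aug 2026), p. 2: "A fundamental open problem asks whether every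
three-dimensional D-solution of (1.1) must be identically zero" — "remains open, even for
axisymmetric D-solutions" (ibid., abstract). We do NOT state the open problem here (it is the route
decl `GaldiLiouville`); we vendor three printed sufficient conditions:

* `galdi_liouville_nineHalves` — Galdi's criterion `U ∈ L^{9/2}(ℝ³) ⇒ U ≡ 0`
  (Galdi 2011, Thm X.9.5; Wang 2025, Thm 2.2; Seregin–Wang 2020, Remark 1.2 (i)).
* `SereginWang2020_annular_liouville` — Seregin–Wang 2020, Thm 1.1 (i) in the Lebesgue instance
  `ℓ = q` (`q > 3`): with `M(R) = R^{2/3 − 3/q} ‖U‖_{L^q(B_R ∖ B_{R/2})}`, `liminf_R M(R) < ∞`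
  already forces a FINITE Dirichlet integral `D(U) ≤ c · liminf M³`, and the smallness
  `liminf M³ ≤ δ D(U)`, `δ < 1/c`, forces `U ≡ 0`. This is the sharpest printed statement AT the
  critical rate `|U| ~ |x|^{-2/3}` (where `M(R) = O(1)`): bounded constants give `D < ∞`, small
  constants give triviality; "any constants ⇒ U ≡ 0" (route decl `CriticalRateLiouville`) is NOT in
  print (Wang 2025 §2.3.3 title "excluding `L̇^{9/2,∞}`" = the closure of `C_c^∞` in weak-`L^{9/2}`;
  Wang–Yang 2026 Thm 1.5 needs an extra `log^{-γ}`, `γ > 1/3`).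
* `KorobkovPileckasRusso2015_liouville_noSwirl` — the axially symmetric case WITHOUT swirl
  (Korobkov–Pileckas–Russo, JMFM 17 (2015); restated in Wang 2025, Thm 3.6 and Wang–Yang 2026 §1).
* `Tsai2021_annular_liouville` — Tsai 2021, Thm 1.1 (a) (whole space): an `H¹_loc` weak solution
  with `liminf_{R→∞} R⁻¹ ‖u‖^{3−δ}_{L^q(R<|x|<LR)} = 0` for some `0 ≤ δ ≤ 1 < L`,
  `q = 6(3−δ)/(6−δ) ∈ [12/5, 3]`, is zero — NO decay, boundedness or finite Dirichlet integral is
  assumed ("a borderline improvement of Seregin–Wang", ibid.). At `δ = 0`, `q = 3` this is the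
  little-`o` form of the critical rate (`|u| ≤ C|x|^{-2/3}` gives `R⁻¹‖u‖³_{L³(R<|x|<LR)} = O(1)`
  only); contrapositively (Tsai 2021, (1.10)–(1.11)) a NONTRIVIAL solution carries
  `R⁻¹ ∫_{R<|x|<LR} |u|³ ≥ ε` on every large annulus — a printed constraint on any witness of the
  route decl `NontrivialDSolutionExists`.

## Rendering choices

* "smooth steady solution" is the tree's profile structure at rate `a = 0`:
  `IsLerayProfile ν 0 U P` (`SelfSimilar.lean`: `U ∈ C²`, `P ∈ C¹`,
  `−νΔU + 0•U + 0•DU[y] + (U·∇)U + ∇P = 0`, `div U = 0`), exactly as the route decls do; where the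
  source says "smooth" we add `ContDiff ℝ ∞`.
* Viscosity. The sources print `ν = 1` ((0.1) of Wang 2025, (1.1) of Seregin–Wang 2020 and of
  Wang–Yang 2026). We state each fact for every `ν > 0`: `(U, P)` solves the `ν`-system iff
  `(ν⁻¹U, ν⁻²P)` solves the `ν = 1` system, and every hypothesis below (membership in `L^{9/2}`,
  finiteness of the annular `liminf`, finite Dirichlet integral, decay, axisymmetry, no swirl) is
  invariant under `U ↦ ν⁻¹U`; the constant `c` of Seregin–Wang is allowed to depend on `ν`
  (`D(νŨ) = ν² D(Ũ)`, `M(νŨ) = ν M(Ũ)`). So each `ν`-family is equivalent to its printed `ν = 1`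
  instance by this substitution; nothing else is generalised.
* Finite Dirichlet integral: `∫⁻ ofReal (frobeniusNormSq (fderiv ℝ U x)) < ∞` (the tree's Frobenius
  norm of the classical derivative, as in `tsai_selfsimilar_local_energy` and the route decls);
  `U → 0 at infinity`: `Tendsto U (cocompact _) (𝓝 0)`.
* Lorentz norms: Seregin–Wang allow `L^{q,ℓ}` on annuli, `q > 3`, `3 ≤ ℓ ≤ ∞`; we vendor only
  `ℓ = q` (Lebesgue norm; `‖f‖_{L^{q,q}} = q^{-1/q}‖f‖_{L^q}`, the factor is absorbed in `c(q, ν)`).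
  The annulus `B_R ∖ B_{R/2}` is rendered with open balls (boundary spheres are null sets).
* Tsai's quantity `R⁻¹‖u‖^{3−δ}_{L^q(R<|x|<LR)}` is `tsaiAnnulusQuantity δ L U R ∈ ℝ≥0∞`
  (`‖u‖^{3−δ}_{L^q} = (∫ |u|^q)^{(6−δ)/6}` since `(3−δ)/q = (6−δ)/6`); its `liminf` at `R → ∞` is
  taken in the complete lattice `ℝ≥0∞` (no junk; the factor `(ofReal R)⁻¹ = ⊤` for `R ≤ 0` is
  irrelevant at `+∞`). Tsai allows `H¹_loc` weak solutions; the `C²` class `IsLerayProfile ν 0 U P`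
  is a sub-case, and `ν > 0` is the printed `ν = 1` applied to `ν⁻¹U` (the vanishing of the
  `liminf` is invariant).

## References

* G. P. Galdi, *An Introduction to the Mathematical Theory of the Navier–Stokes Equations.
  Steady-State Problems*, 2nd ed., Springer (2011): Introduction p. 12 (open problem), Remark
  X.9.4, Theorem X.9.5 (p. 729). [Galdi2011] (not held; statement taken from the two restatements
  below, which agree.)
* G. Seregin, W. Wang, *Sufficient conditions on Liouville type theorems for the 3D steady
  Navier–Stokes equations*, Algebra i Analiz 31 (2019) = St. Petersburg Math. J. 31 (2020) 387–393,
  arXiv:1805.02227: Theorem 1.1, Remarks 1.2. [SereginWang2020]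
* M. Korobkov, K. Pileckas, R. Russo, *The Liouville theorem for the steady-state Navier–Stokes
  problem for axially symmetric 3D solutions in absence of swirl*, J. Math. Fluid Mech. 17 (2015)
  287–293 (+ Addendum, JMFM 18 (2016) 207). [KorobkovPileckasRusso2015] (paywalled, acquisition
  acq-02064; statement as restated in [Wang2025SteadyLiouville] Thm 3.6.)
* W. Wang (王文栋), *稳态Navier–Stokes方程的Liouville定理* (Liouville theorems for the steady
  Navier–Stokes equations), Science Press, Beijing (2025): (0.1)–(0.3), Thm 2.2 + Remark 2.2,
  Thm 2.4 + Remark 2.3, §3 p. 41, Thm 3.6. [Wang2025SteadyLiouville]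
* W. Wang, G. Yang, arXiv:2608.06040 (2026), §1, Prop. 1.4, Thms 1.5–1.6. [WangYang2026]
* T.-P. Tsai, *Liouville type theorems for stationary Navier–Stokes equations*, SN Partial Differ.
  Equ. Appl. 2 (2021), Paper No. 10 (arXiv:2005.09691): §1 (survey), Thm 1.1, (1.10)–(1.11).
  [Tsai2021]
-/

noncomputable section

open MeasureTheory Filter Set Metric
open scoped ENNReal Topology

namespace Literature.Analysis.FluidPDE

local notation "ℝ³" => EuclideanSpace ℝ (Fin 3)

/-! ### Galdi's `L^{9/2}` criterion -/

/-- **Galdi's Liouville criterion for D-solutions** (Galdi 2011, Theorem X.9.5; as restated in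
Wang 2025, Thm 2.2: "under (0.1) [`−ΔU + U·∇U = −∇P`, `div U = 0` on `ℝ³`], (0.2)
[`U → 0` as `|x| → ∞`] and (0.3) [`∫|∇U|² < ∞`], if moreover `U ∈ L^{9/2}(ℝ³)`, the Liouville
theorem holds", i.e. `U ≡ 0`; also Seregin–Wang 2020, Remark 1.2 (i)). Stated for every viscosity
`ν > 0` (equivalent to the printed `ν = 1` by `U ↦ ν⁻¹U`, `P ↦ ν⁻²P`, module docstring). A smooth
(`C²`) steady solution is rendered as `IsLerayProfile ν 0 U P`. Partial result towards the OPEN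
Liouville problem for D-solutions (route decl `GaldiLiouville`); by Sobolev a D-solution is only
in `L⁶`. [cite: Galdi2011, Thm X.9.5] -/
def galdi_liouville_nineHalves : Prop :=
  ∀ ν : ℝ, 0 < ν → ∀ (U : ℝ³ → ℝ³) (P : ℝ³ → ℝ), IsLerayProfile ν 0 U P →
    (∫⁻ x, ENNReal.ofReal (frobeniusNormSq (fderiv ℝ U x)) < ∞) →
    Tendsto U (cocompact ℝ³) (𝓝 0) →
    MemLp U (9 / 2 : ℝ≥0∞) volume → U = 0

/-! ### Seregin–Wang: annular Morrey-type criterion at the critical rate `2/3` -/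

/-- The annular Morrey-type quantity of Seregin–Wang 2020 (display before Thm 1.1) in the Lebesgue
instance `ℓ = q`: `M_{2/3,q,q}(R) = R^{2/3 − 3/q} ‖U‖_{L^q(B_R ∖ B_{R/2})}`, valued in `ℝ≥0∞`
(balls centred at the origin; open balls, the spheres being null). At the critical decay
`|U(x)| ≤ C|x|^{-2/3}` one has `M(R) ≤ C'` for all `R`. [cite: SereginWang2020, §1 (definition of M_{γ,q,ℓ})] -/
def annularMorrey (q : ℝ) (U : ℝ³ → ℝ³) (R : ℝ) : ℝ≥0∞ :=
  ENNReal.ofReal (R ^ (2 / 3 - 3 / q)) *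
    (∫⁻ x in ball (0 : ℝ³) R \ ball (0 : ℝ³) (R / 2), ‖U x‖ₑ ^ q) ^ (1 / q)

/-- **Seregin–Wang 2020, Theorem 1.1 (i)** (Lebesgue instance `ℓ = q`, any `q > 3`): "Let `u` and
`p` be a smooth solution to `−Δu + u·∇u = −∇p`, `div u = 0` [in `ℝ³`]. (i) For `q > 3`,
`3 ≤ ℓ ≤ ∞`, `γ = 2/3`, assume that `liminf_{R→∞} M_{2/3,q,ℓ}(R) < ∞`; then
`D(u) := ∫_{ℝ³} |∇u|² dx ≤ c(q,ℓ) liminf_{R→∞} M³_{2/3,q,ℓ}(R)`. Moreover, if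
`liminf_{R→∞} M³_{2/3,q,ℓ}(R) ≤ δ D(u)` for some `0 < δ < 1/c(q,ℓ)`, then `u ≡ 0`."
Here with `M = annularMorrey q U` (`ℓ = q`), for every viscosity `ν > 0` with a constant
`c = c(q, ν) > 0` (printed for `ν = 1`; `U ↦ ν⁻¹U` gives the family, module docstring), smooth
solutions rendered as `IsLerayProfile ν 0 U P` plus `C^∞`. NO decay or finite-energy hypothesis is
made: finiteness of the Dirichlet integral is part of the conclusion. Consequences in print:
Galdi's `L^{9/2}` criterion (Remark 1.2 (i)); `u ∈ L̇^{9/2,∞}` or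
`liminf R^{-1/3}‖u‖_{L³(B_R∖B_{R/2})} = 0` suffice (Wang 2025, Remark 2.3). At the exact rate
`|u| = O(|x|^{-2/3})` with LARGE constants only `D(u) < ∞` follows — triviality there is not in
print (route decl `CriticalRateLiouville`). [cite: SereginWang2020, Thm 1.1 (i)] -/
def SereginWang2020_annular_liouville : Prop :=
  ∀ ν : ℝ, 0 < ν → ∀ q : ℝ, 3 < q → ∃ c : ℝ, 0 < c ∧
    ∀ (U : ℝ³ → ℝ³) (P : ℝ³ → ℝ), IsLerayProfile ν 0 U P →
      ContDiff ℝ (⊤ : ℕ∞) U → ContDiff ℝ (⊤ : ℕ∞) P →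
      liminf (annularMorrey q U) atTop < ∞ →
        (∫⁻ x, ENNReal.ofReal (frobeniusNormSq (fderiv ℝ U x))
            ≤ ENNReal.ofReal c * (liminf (annularMorrey q U) atTop) ^ (3 : ℕ)) ∧
        (∀ δ : ℝ, 0 < δ → δ * c < 1 →
          (liminf (annularMorrey q U) atTop) ^ (3 : ℕ)
              ≤ ENNReal.ofReal δ * ∫⁻ x, ENNReal.ofReal (frobeniusNormSq (fderiv ℝ U x)) →
          U = 0)

/-! ### Korobkov–Pileckas–Russo: axially symmetric D-solutions without swirl -/

/-- **Liouville theorem for axially symmetric D-solutions with no swirl** (Korobkov–Pileckas–Russo,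
J. Math. Fluid Mech. 17 (2015) 287–293, main theorem; as restated in Wang 2025, Thm 3.6: "under
(0.1), (0.2) and (0.3), if `u` is axially symmetric and `u_θ = 0`, the Liouville theorem holds",
and in Wang–Yang 2026, §1: "In the no-swirl case `u_θ ≡ 0`, Liouville theorems were established by
KNSŠ09 and KPR15"). For every `ν > 0` (printed `ν = 1`; `U ↦ ν⁻¹U`): a `C²` steady solution
`IsLerayProfile ν 0 U P` on `ℝ³` which is axisymmetric about the `x₂`-axis (`IsAxisymmetric`,
KNSS convention of the tree) with no swirl (`HasNoSwirl`: `Γ = x₀u₁ − x₁u₀ ≡ 0`), has finite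
Dirichlet integral and tends to `0` at infinity, vanishes identically. (KPR prove it for all
D-solutions, which are smooth; the `C²` class here is a sub-case.) The case WITH swirl is open
(Wang–Yang 2026, abstract; route decl `AxisymGaldiLiouville`). Primary source paywalled at
vendoring time (acq-02064): theorem number to be sharpened on reground. [cite: KorobkovPileckasRusso2015, main Theorem (JMFM 17, pp. 287–293); restated Wang2025SteadyLiouville Thm 3.6] -/
def KorobkovPileckasRusso2015_liouville_noSwirl : Prop :=
  ∀ ν : ℝ, 0 < ν → ∀ (U : ℝ³ → ℝ³) (P : ℝ³ → ℝ), IsLerayProfile ν 0 U P →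
    IsAxisymmetric U → HasNoSwirl U →
    (∫⁻ x, ENNReal.ofReal (frobeniusNormSq (fderiv ℝ U x)) < ∞) →
    Tendsto U (cocompact ℝ³) (𝓝 0) → U = 0

/-! ### Tsai 2021: vanishing annular `liminf`, no decay assumed -/

/-- Tsai's annular quantity `R⁻¹ ‖U‖^{3−δ}_{L^q(R<|x|<LR)}` with `q = q(δ) = 6(3−δ)/(6−δ)`
(Tsai 2021, Thm 1.1 (a), display (1.6)), valued in `ℝ≥0∞`:
`(ofReal R)⁻¹ · (∫_{R<‖x‖<LR} ‖U x‖^q)^{(6−δ)/6}` (note `(3−δ)/q = (6−δ)/6`). For `δ = 0`: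
`R⁻¹ ∫_{R<|x|<LR} |U|³`; for `δ = 1`: `R⁻¹ ‖U‖²_{L^{12/5}(R<|x|<LR)}`. [cite: Tsai2021, Thm 1.1 (a)] -/
def tsaiAnnulusQuantity (δ L : ℝ) (U : ℝ³ → ℝ³) (R : ℝ) : ℝ≥0∞ :=
  (ENNReal.ofReal R)⁻¹ *
    (∫⁻ x in {x : ℝ³ | R < ‖x‖ ∧ ‖x‖ < L * R}, ‖U x‖ₑ ^ (6 * (3 - δ) / (6 - δ))) ^ ((6 - δ) / 6)

/-- **Tsai 2021, Theorem 1.1 (a)** (whole space): "Suppose `u ∈ H¹_loc(ℝ³)` is a weak solution of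
`−Δu + (u·∇)u + ∇p = 0`, `div u = 0` in `Ω = ℝ³`. (a) If for some constants `0 ≤ δ ≤ 1` and
`L > 1`, `liminf_{R→∞} R⁻¹ ‖u‖^{3−δ}_{L^{q}(R<|x|<LR)} = 0`, `q(δ) = (3−δ)/(1−δ/6)`, then `u = 0`."
("We do not assume `u ∈ L^∞` nor `∇u ∈ L²`"; the conditions "use `liminf`, not limit".) Here for
`C²` steady solutions `IsLerayProfile ν 0 U P` and every `ν > 0` (printed `ν = 1`; `U ↦ ν⁻¹U`,
module docstring), with the quantity `tsaiAnnulusQuantity δ L U`. At `δ = 0` the hypothesis is the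
little-`o` version of the critical decay `|u| ~ |x|^{-2/3}` — compare the route decl
`CriticalRateLiouville` (big-`O` with arbitrary constants, not in print) — and its contrapositive is
Tsai's lower bound (1.11): a nonzero solution has `R⁻¹∫_{R<|x|<LR}|u|³ ≥ ε` for all large `R`.
[cite: Tsai2021, Thm 1.1 (a)] -/
def Tsai2021_annular_liouville : Prop :=
  ∀ ν : ℝ, 0 < ν → ∀ (U : ℝ³ → ℝ³) (P : ℝ³ → ℝ), IsLerayProfile ν 0 U P →
    ∀ (δ L : ℝ), 0 ≤ δ → δ ≤ 1 → 1 < L →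
      liminf (tsaiAnnulusQuantity δ L U) atTop = 0 → U = 0

/-! ### Sanity links (proved) -/

/-- The zero field satisfies the hypotheses and the conclusion of Galdi's criterion (non-vacuity
of the hypothesis class: `IsLerayProfile.zero`, `MemLp` of `0`). [folklore] -/
theorem galdi_liouville_nineHalves_zero_instance (ν : ℝ) :
    IsLerayProfile ν 0 (0 : ℝ³ → ℝ³) (0 : ℝ³ → ℝ) ∧
      MemLp (0 : ℝ³ → ℝ³) (9 / 2 : ℝ≥0∞) volume ∧
      Tendsto (0 : ℝ³ → ℝ³) (cocompact ℝ³) (𝓝 0) :=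
  ⟨IsLerayProfile.zero ν 0, MemLp.zero, tendsto_const_nhds⟩

/-- Under Seregin–Wang's theorem, a smooth steady solution whose annular quantity has
`liminf = 0` (e.g. `U ∈ L^{9/2}`, or `|U| = o(|x|^{-2/3})`) is trivial: the smallness clause holds
with any admissible `δ` since its left side vanishes (Seregin–Wang 2020, Remark 1.2 (i); Wang 2025,
Remark 2.3 (2)). [cite: SereginWang2020, Remark 1.2 (i)] -/
theorem SereginWang2020_annular_liouville.of_liminf_eq_zero
    (h : SereginWang2020_annular_liouville) {ν : ℝ} (hν : 0 < ν) {q : ℝ} (hq : 3 < q)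
    {U : ℝ³ → ℝ³} {P : ℝ³ → ℝ} (hUP : IsLerayProfile ν 0 U P)
    (hU : ContDiff ℝ (⊤ : ℕ∞) U) (hP : ContDiff ℝ (⊤ : ℕ∞) P)
    (h0 : liminf (annularMorrey q U) atTop = 0) : U = 0 := by
  obtain ⟨c, hc, hall⟩ := h ν hν q hq
  have hfin : liminf (annularMorrey q U) atTop < ∞ := by rw [h0]; exact ENNReal.zero_lt_top
  obtain ⟨_, hsmall⟩ := hall U P hUP hU hP hfin
  -- δ := 1/(2c) is admissible: δ * c = 1/2 < 1
  refine hsmall (1 / (2 * c)) (by positivity) ?_ ?_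
  · field_simp; norm_num
  · rw [h0]; simp

/-- **Tsai's lower bound for nontrivial solutions** (Tsai 2021, (1.10)–(1.11), the contrapositive
of Thm 1.1 (a)): under `Tsai2021_annular_liouville`, a steady solution which is NOT identically
zero has `liminf_{R→∞} R⁻¹‖U‖^{3−δ}_{L^q(R<|x|<LR)} ≠ 0` for every admissible `δ`, `L`. [cite: Tsai2021, (1.10)–(1.11)] -/
theorem Tsai2021_annular_liouville.liminf_ne_zero (h : Tsai2021_annular_liouville) {ν : ℝ}
    (hν : 0 < ν) {U : ℝ³ → ℝ³} {P : ℝ³ → ℝ} (hUP : IsLerayProfile ν 0 U P) (hU : U ≠ 0)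
    {δ L : ℝ} (hδ0 : 0 ≤ δ) (hδ1 : δ ≤ 1) (hL : 1 < L) :
    liminf (tsaiAnnulusQuantity δ L U) atTop ≠ 0 :=
  fun h0 => hU (h ν hν U P hUP δ L hδ0 hδ1 hL h0)

end Literature.Analysis.FluidPDE

end
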